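import Summits.CriticalPhenomena.CardyFormulaZ2.Theorems.CardyComplexConeEdgePrecompactUFRSRectBoundaryStrandDecayCases

/-!
# The single-scale boundary bridge of the UFRS collar decay on rectangles, from HT, HJ and ONE
(line `qkz-strip-boundary-arm` of crux `CardyComplexCone.EdgePrecompact`, stmt-CriticalPhenomena-11387;
registered sub-goal `ufrs_rectBoundaryStrandDecay_of_bridges`: the bookkeeping reduction of the
registered bridge `ufrs_rectBoundaryStrandDecay` (BSD, the hypothesis of the landed M3 theorem
`ufrs_screenedCollarDecay_rect_of_boundaryStrandDecay`) to three single-scale decay statements)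

BSD asks, for an open axis-parallel rectangle `D`, constants `C, α, K > 0` such that for EVERY
collar width `η > 0` and fine admissible data `E` of `D`, shifts `‖E.δ w‖ < η`, boundary points
`z ∈ ∂D` and scales `8η ≤ r`, `K r ≤ R`:
* (one-arm clause) `P(ufrsStrands E w z 3 r R) ≤ C (r/R)^α`;
* (three-arm clause) the same with exponent `1 + α` if no marked (`A`–`B`) edge of `E` or of
  `shiftData E w` has its midpoint within `2R` of `z`.

It is proved here from three inputs, all in the format "`∃ C α, ∃ η₀, ∀ η < η₀, ∃ δ₀, …`" at centres
`z ∈ D` with `infDist z Dᶜ ≤ s`: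
* **HT** — the registered neighbour bridge `ufrs_rect_flatThreeStrandDecay` (three strands, rate
  `(s/S)^{1+α}`, marked midpoints at distance `≥ 2S`);
* **HJ** — the registered neighbour bridge `ufrs_rect_junctionTwoStrandDecay` (two strands around the
  midpoint of a marked edge, rate `(s/S)^β`);
* **ONE** — the registered sub-goal `ufrs_rect_oneStrandDecay` (ONE strand, rate `(s/S)^α`, marked
  midpoints at distance `≥ 2S`), stated below verbatim as the third hypothesis.

Why three inputs and not "HT + a one-strand bound everywhere": at the junction of the wired arc and
the free arc ONE strand-crossing is free of charge (the exploration path itself), so no one-strand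
bound can hold near the marked edges; there the one-arm clause of BSD is the two-strand junction
decay HJ (three strands contain two), re-centred at the marked midpoint.

Proof (bookkeeping only):
1. `∀ η > 0` versus `∀ η < η₀`: with `K ≥ (|∂D|/η₀ + 1)` a radius `R ≥ K · 8η`, `η ≥ η₀`, exceeds
   `(x₁ - x₀) + (y₁ - y₀) + η`, and then `ufrsStrands E w z k r R = ∅`: every vertex of a corner with
   an inner face of `E` (resp. of the translate) is a point of `D` (resp. of `D + E.δ w`)
   (`ufrsStrands_eq_empty_of_far`); the same disposes of `R ≥ (x₁ - x₀) + (y₁ - y₀) + η₀` for `η < η₀`.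
2. Re-centring (`exists_recentre`, `ufrsStrands_mono`): a point `z' ∈ D` with `dist z z' < r/4`,
   `infDist z' Dᶜ ≤ r/4`; strands across `A(z; r, R)` are strands across `A(z'; 2r, R')` for
   `R' ≤ R - r/4`, and marked midpoints at distance `> 2R` from `z` are at distance `≥ R` from `z'`.
   The three-arm clause is HT at `(z'; 2r, R/2)`.
3. One-arm clause: shrink the outer radius to `R₁ = min R (L₀/16)` (`L₀` the short side; this costs
   the factor `M = 16 R₀/L₀` in the ratio since `R < R₀`), dispose of `R₁ ≤ 2^10 r` by `C ≥ 2^14 R₀/L₀`,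
   and let `u` be the distance from `z` to the nearest of the (at most four) marked midpoints
   (`exists_junctionFinset`): `u ≤ 32 r` — HJ at the midpoint, annulus `A(m; 33r, R₁ - 32r)`;
   `u ≥ R₁` — ONE at `(z'; 2r, R₁/2 - r)`; `R₁/8 ≤ u < R₁` — ONE at `(z'; 2r, u/8)`;
   `32 r < u < R₁/8` — ONE at `(z'; 2r, u/8)` AND HJ at `(m; 2u, R₁ - u)`, two events read off
   disjoint edge sets (`determinedBy_ufrsStrands_ball/beyond`), hence independent
   (`bondPercolation_real_inter_of_disjoint`): `(16r/u)^γ (4u/R₁)^γ = (64 r/R₁)^γ`.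
   The exponent is `γ = min (α_T, α_1, β, 1)`.

References: G. F. Lawler, O. Schramm, W. Werner, Electron. J. Probab. 7 (2002), App. A (boundary arm
events); H. Kesten, Comm. Math. Phys. 109 (1987) (splitting arm events at an intermediate scale);
S. Smirnov, C. R. Acad. Sci. Paris 333 (2001), §2; G. Grimmett, *Percolation* (1999), §11.8.
-/

set_option linter.unusedVariables false

namespace Summit.CriticalPhenomena.CardyFormulaZ2.Cruxes.EdgePrecompact.QkzStripBoundaryArm

open MeasureTheory Filter Set Metric
open scoped Topology BigOperators Pointwise
open Literature.Probability.LatticeModels Literature.Probability.Percolation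
open Literature.Probability.RandomPlanarGeometry (DobrushinDomain)
open Summit.CriticalPhenomena.CardyFormulaZ2.Theses.CardyComplexCone

noncomputable section

/-! ## The product case of the one-arm clause -/

/-- **Case (B2b): the nearest marked midpoint `m` at distance `u ∈ (32 r, R₁/8)`.** The inner
one-strand event around `z'` (scales `2r`, `u/8`) and the junction two-strand event around `m`
(scales `2u`, `R₁ - u`) are read off disjoint sets of edges, hence independent under `P_{1/2}`; the
product of their bounds is `64 C₁ C_J (r/R₁)^γ`. -/
theorem oneArm_split {Dc : Set ℂ} {E : DiscreteDobrushin} {w : Site 2} {η C1 α1 CJ β γ r u R₁ : ℝ}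
    {z z' : ℂ} (hδ : 0 < E.δ) (hδη : E.δ < η) (hC1 : 0 < C1) (hCJ : 0 < CJ) (hγ : 0 < γ) (hγ1 : γ ≤ 1)
    (hγ1' : γ ≤ α1) (hγβ : γ ≤ β)
    (hOloc : ∀ (c : ℂ) (s S : ℝ), c ∈ Dc → infDist c Dcᶜ ≤ s → η ≤ s → 0 < S →
      (∀ e₀ : Sym2 (Site 2), (e₀ ∈ E.zdABEdges ∨ e₀ ∈ (shiftData E w).zdABEdges) →
        2 * S ≤ dist (medialPoint E.δ e₀) c) →
      (bondPercolation (zdGraph 2) half).real (ufrsStrands E w c 1 s S) ≤ C1 * (s / S) ^ α1)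
    (hJloc : ∀ e₀ : Sym2 (Site 2), (e₀ ∈ E.zdABEdges ∨ e₀ ∈ (shiftData E w).zdABEdges) →
      ∀ s S : ℝ, η ≤ s → 0 < S →
        (bondPercolation (zdGraph 2) half).real (ufrsStrands E w (medialPoint E.δ e₀) 2 s S) ≤ CJ * (s / S) ^ β)
    (hz'D : z' ∈ Dc) (hz'd : infDist z' Dcᶜ ≤ r / 4) (hzz' : dist z z' < r / 4)
    {e₀ : Sym2 (Site 2)} (he₀ : e₀ ∈ E.zdABEdges ∨ e₀ ∈ (shiftData E w).zdABEdges)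
    (hme : dist (medialPoint E.δ e₀) z = u)
    (hjf : ∀ e : Sym2 (Site 2), (e ∈ E.zdABEdges ∨ e ∈ (shiftData E w).zdABEdges) →
      2 * (u / 8) ≤ dist (medialPoint E.δ e) z')
    (hηr : 8 * η ≤ r) (hr : 0 < r) (hu32 : 32 * r < u) (hu8 : 8 * u < R₁) :
    (bondPercolation (zdGraph 2) half).real (ufrsStrands E w z 3 r R₁) ≤ 64 * C1 * CJ * (r / R₁) ^ γ := by
  set μ := bondPercolation (zdGraph 2) half with hμ
  have hu0 : 0 < u := by linarith
  have hR₁0 : 0 < R₁ := by linarith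
  have hin_le := inner_oneStrand_le hC1 hγ hγ1 hγ1' hOloc hz'D hz'd hjf hηr hr hu32
  have hbout := hJloc e₀ he₀ (2 * u) (R₁ - u) (by linarith) (by linarith)
  have hratio_out : 2 * u / (R₁ - u) ≤ 4 * (u / R₁) :=
    calc 2 * u / (R₁ - u) ≤ 2 * u / (R₁ / 2) :=
          div_le_div_of_nonneg_left (by positivity) (by positivity) (by linarith)
      _ = 4 * (u / R₁) := by field_simp; ring
  have h4 : 4 * (u / R₁) ≤ 1 := by
    rw [mul_div_assoc', div_le_one hR₁0]; linarith
  have hout_le : μ.real (ufrsStrands E w (medialPoint E.δ e₀) 2 (2 * u) (R₁ - u)) ≤ CJ * (4 * (u / R₁) ^ γ) :=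
    calc μ.real (ufrsStrands E w (medialPoint E.δ e₀) 2 (2 * u) (R₁ - u))
        ≤ CJ * (2 * u / (R₁ - u)) ^ β := hbout
      _ ≤ CJ * (4 * (u / R₁)) ^ β :=
          mul_le_mul_of_nonneg_left
            (Real.rpow_le_rpow (div_nonneg (by positivity) (by linarith)) hratio_out (by linarith)) hCJ.le
      _ ≤ CJ * (4 * (u / R₁) ^ γ) :=
          mul_le_mul_of_nonneg_left (rpow_ratio_le (by positivity) (by norm_num) h4 hγ hγ1 hγβ) hCJ.le
  have hsubin : ufrsStrands E w z 3 r R₁ ⊆ ufrsStrands E w z' 1 (2 * r) (u / 8) :=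
    (ufrsStrands_castLE _ _ _ _ _ _ _ (by norm_num : 1 ≤ 3)).trans
      (ufrsStrands_mono (by linarith [hzz'.le]) (by linarith [hzz'.le]))
  have hsubout : ufrsStrands E w z 3 r R₁ ⊆ ufrsStrands E w (medialPoint E.δ e₀) 2 (2 * u) (R₁ - u) := by
    refine (ufrsStrands_castLE _ _ _ _ _ _ _ (by norm_num : 2 ≤ 3)).trans (ufrsStrands_mono ?_ ?_)
    · rw [dist_comm, hme]; linarith
    · rw [dist_comm, hme]; linarith
  -- independence: the two events read disjoint sets of edges
  have hind : μ.real (ufrsStrands E w z' 1 (2 * r) (u / 8) ∩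
      ufrsStrands E w (medialPoint E.δ e₀) 2 (2 * u) (R₁ - u)) =
      μ.real (ufrsStrands E w z' 1 (2 * r) (u / 8)) *
        μ.real (ufrsStrands E w (medialPoint E.δ e₀) 2 (2 * u) (R₁ - u)) := by
    refine bondPercolation_real_inter_of_disjoint (zdGraph 2) half ?_
      (determinedBy_ufrsStrands_ball hδ w z' 1 (show 2 * r < u / 8 by linarith))
      (determinedBy_ufrsStrands_beyond hδ w (medialPoint E.δ e₀) 2 (show 2 * u < R₁ - u by linarith))
      (measurableSet_ufrsStrands hδ w z' 1 (show 2 * r < u / 8 by linarith))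
      (measurableSet_ufrsStrands hδ w (medialPoint E.δ e₀) 2 (show 2 * u < R₁ - u by linarith))
    rw [Set.disjoint_left]
    intro e h1 h2
    induction e using Sym2.ind with
    | h x y =>
      have hx1 := h1 x (Sym2.mem_mk_left x y)
      have hx2 := h2 x (Sym2.mem_mk_left x y)
      linarith [dist_triangle (meshPoint E.δ x) z' z, dist_triangle (meshPoint E.δ x) z (medialPoint E.δ e₀),
        dist_comm z z', dist_comm (medialPoint E.δ e₀) z]
  calc μ.real (ufrsStrands E w z 3 r R₁)
      ≤ μ.real (ufrsStrands E w z' 1 (2 * r) (u / 8) ∩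
          ufrsStrands E w (medialPoint E.δ e₀) 2 (2 * u) (R₁ - u)) :=
        measureReal_mono (Set.subset_inter hsubin hsubout) (measure_ne_top _ _)
    _ = μ.real (ufrsStrands E w z' 1 (2 * r) (u / 8)) *
          μ.real (ufrsStrands E w (medialPoint E.δ e₀) 2 (2 * u) (R₁ - u)) := hind
    _ ≤ (C1 * (16 * (r / u) ^ γ)) * (CJ * (4 * (u / R₁) ^ γ)) :=
        mul_le_mul hin_le hout_le measureReal_nonneg (by positivity)
    _ = (64 * C1 * CJ) * ((r / u) ^ γ * (u / R₁) ^ γ) := by ring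
    _ = 64 * C1 * CJ * (r / R₁) ^ γ := by
        rw [← Real.mul_rpow (by positivity) (by positivity)]
        congr 2
        field_simp

/-! ## The reduction -/

/-- **BSD from HT, HJ and ONE** (registered sub-goal `ufrs_rectBoundaryStrandDecay_of_bridges` of
stmt-CriticalPhenomena-11387). The three hypotheses are, verbatim, the registered bridges
`ufrs_rect_flatThreeStrandDecay` (HT), `ufrs_rect_junctionTwoStrandDecay` (HJ) and the registered
one-strand decay away from the marked edges `ufrs_rect_oneStrandDecay` (ONE); the conclusion is the
registered bridge `ufrs_rectBoundaryStrandDecay` verbatim. See the module docstring for the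
bookkeeping (emptiness beyond the diameter, re-centring at an interior point, shrinking the outer
radius below the short side, and the case analysis on the distance to the nearest marked midpoint). -/
theorem ufrs_rectBoundaryStrandDecay_of_bridges : (∀ (D : DobrushinDomain), (∃ x₀ x₁ y₀ y₁ : ℝ, x₀ < x₁ ∧ y₀ < y₁ ∧ D.carrier = Set.Ioo x₀ x₁ ×ℂ Set.Ioo y₀ y₁) → ∃ C α : ℝ, 0 < C ∧ 0 < α ∧ ∃ η₀ > (0:ℝ), ∀ η : ℝ, 0 < η → η < η₀ → ∃ δ₀ > (0:ℝ), ∀ E : DiscreteDobrushin, E.Ω = D.carrier → E.IsZdAdmissible → E.δ < δ₀ → ∀ w : Site 2, ‖meshPoint E.δ w‖ < η → ∀ (z : ℂ) (s S : ℝ), z ∈ D.carrier → infDist z D.carrierᶜ ≤ s → η ≤ s → 0 < S → (∀ e₀ : Sym2 (Site 2), (e₀ ∈ E.zdABEdges ∨ e₀ ∈ (shiftData E w).zdABEdges) → 2 * S ≤ dist (medialPoint E.δ e₀) z) → (bondPercolation (zdGraph 2) half).real (ufrsStrands E w z 3 s S) ≤ C * (s / S) ^ (1 + α)) → (∀ (D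 : DobrushinDomain), (∃ x₀ x₁ y₀ y₁ : ℝ, x₀ < x₁ ∧ y₀ < y₁ ∧ D.carrier = Set.Ioo x₀ x₁ ×ℂ Set.Ioo y₀ y₁) → ∃ C β : ℝ, 0 < C ∧ 0 < β ∧ ∃ η₀ > (0:ℝ), ∀ η : ℝ, 0 < η → η < η₀ → ∃ δ₀ > (0:ℝ), ∀ E : DiscreteDobrushin, E.Ω = D.carrier → E.IsZdAdmissible → E.δ < δ₀ → ∀ w : Site 2, ‖meshPoint E.δ w‖ < η → ∀ e₀ : Sym2 (Site 2), (e₀ ∈ E.zdABEdges ∨ e₀ ∈ (shiftData E w).zdABEdges) → ∀ s S : ℝ, η ≤ s → 0 < S → (bondPercolation (zdGraph 2) half).real (ufrsStrands E w (medialPoint E.δ e₀) 2 s S) ≤ C * (s / S) ^ β) → (∀ (D : DobrushinDomain), (∃ x₀ x₁ y₀ y₁ : ℝ, x₀ < x₁ ∧ y₀ < y₁ ∧ D.carrier = Set.Ioo x₀ x₁ ×ℂ Set.Ioo y₀ y₁) → ∃ C α : ℝ, 0 < C ∧ 0 < α ∧ ∃ η₀ > (0:ℝ), ∀ η : ℝ,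 0 < η → η < η₀ → ∃ δ₀ > (0:ℝ), ∀ E : DiscreteDobrushin, E.Ω = D.carrier → E.IsZdAdmissible → E.δ < δ₀ → ∀ w : Site 2, ‖meshPoint E.δ w‖ < η → ∀ (z : ℂ) (s S : ℝ), z ∈ D.carrier → infDist z D.carrierᶜ ≤ s → η ≤ s → 0 < S → (∀ e₀ : Sym2 (Site 2), (e₀ ∈ E.zdABEdges ∨ e₀ ∈ (shiftData E w).zdABEdges) → 2 * S ≤ dist (medialPoint E.δ e₀) z) → (bondPercolation (zdGraph 2) half).real (ufrsStrands E w z 1 s S) ≤ C * (s / S) ^ α) → ∀ (D : DobrushinDomain), (∃ x₀ x₁ y₀ y₁ : ℝ, x₀ < x₁ ∧ y₀ < y₁ ∧ D.carrier = Set.Ioo x₀ x₁ ×ℂ Set.Ioo y₀ y₁) → ∃ C α K : ℝ, 0 < C ∧ 0 < α ∧ 0 < K ∧ ∀ η : ℝ, 0 < η → ∃ δ₁ > (0:ℝ), ∀ E : DiscreteDobrushin, E.Ω = D.carrier → E.IsZdAdmissible → E.δ < δ₁ → ∀ w : Site 2, ‖meshPoint E.δ w‖ < η → ∀ (z : ℂ)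 (r R : ℝ), z ∈ frontier D.carrier → 8 * η ≤ r → K * r ≤ R → (bondPercolation (zdGraph 2) half).real (ufrsStrands E w z 3 r R) ≤ C * (r / R) ^ α ∧ (z ∉ ufrsMarkedNbhd E w (2 * R) → (bondPercolation (zdGraph 2) half).real (ufrsStrands E w z 3 r R) ≤ C * (r / R) ^ (1 + α)) := by
  intro hT hJ hO D hrect
  obtain ⟨x₀, x₁, y₀, y₁, hx, hy, hD⟩ := hrect
  obtain ⟨CT, αT, hCT, hαT, ηT, hηT, hT⟩ := hT D ⟨x₀, x₁, y₀, y₁, hx, hy, hD⟩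
  obtain ⟨CJ, β, hCJ, hβ, ηJ, hηJ, hJ⟩ := hJ D ⟨x₀, x₁, y₀, y₁, hx, hy, hD⟩
  obtain ⟨C1, α1, hC1, hα1, η1, hη1, hO⟩ := hO D ⟨x₀, x₁, y₀, y₁, hx, hy, hD⟩
  set μ := bondPercolation (zdGraph 2) half with hμ
  -- geometry of `D`
  have hDopen : IsOpen D.carrier := by rw [hD]; exact isOpen_Ioo.reProdIm isOpen_Ioo
  set Lsum : ℝ := (x₁ - x₀) + (y₁ - y₀) with hLsumdef
  have hLsum : 0 < Lsum := by rw [hLsumdef]; linarith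
  set L₀ : ℝ := min (x₁ - x₀) (y₁ - y₀) with hL₀def
  have hL₀ : 0 < L₀ := lt_min (by linarith) (by linarith)
  have hL₀x : L₀ ≤ x₁ - x₀ := min_le_left _ _
  set η₀ : ℝ := min ηT (min ηJ η1) with hη₀def
  have hη₀ : 0 < η₀ := lt_min hηT (lt_min hηJ hη1)
  set R₀ : ℝ := Lsum + η₀ with hR₀def
  have hR₀L : L₀ ≤ R₀ := by rw [hR₀def, hLsumdef]; linarith
  have hR₀ : 0 < R₀ := by linarith
  -- the exponent
  set γ : ℝ := min (min αT (min α1 β)) 1 with hγdef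
  have hγ : 0 < γ := lt_min (lt_min hαT (lt_min hα1 hβ)) one_pos
  have hγ1 : γ ≤ 1 := min_le_right _ _
  have hγT : γ ≤ αT := (min_le_left _ _).trans (min_le_left _ _)
  have hγ1' : γ ≤ α1 := (min_le_left _ _).trans ((min_le_right _ _).trans (min_le_left _ _))
  have hγβ : γ ≤ β := (min_le_left _ _).trans ((min_le_right _ _).trans (min_le_right _ _))
  -- the constants
  set M : ℝ := 16 * R₀ / L₀ with hMdef
  have hM1 : 1 ≤ M := by rw [hMdef, le_div_iff₀ hL₀]; linarith
  set CD : ℝ := 2 ^ 14 * R₀ / L₀ with hCDdef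
  have hCD1 : (2:ℝ) ^ 14 ≤ CD := by rw [hCDdef, le_div_iff₀ hL₀]; linarith
  set K : ℝ := max (2 ^ 12) (Lsum / η₀ + 1) with hKdef
  have hK12 : (2:ℝ) ^ 12 ≤ K := le_max_left _ _
  have hK : 0 < K := lt_of_lt_of_le (by norm_num) hK12
  have hCJ64 : 0 ≤ 64 * C1 * CJ := by positivity
  have hCT4 : 0 ≤ CT * (4:ℝ) ^ (1 + αT) := by positivity
  set A : ℝ := CT * (4:ℝ) ^ (1 + αT) + 66 * CJ + 128 * C1 + 64 * C1 * CJ with hAdef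
  have hA3 : CT * (4:ℝ) ^ (1 + αT) ≤ A := by rw [hAdef]; linarith
  have hA0 : 0 ≤ A := le_trans (by positivity) hA3
  set C : ℝ := A * M + CD with hCdef
  have hM0 : 0 ≤ M := le_trans zero_le_one hM1
  have hCD0 : 0 ≤ CD := le_trans (by norm_num) hCD1
  have hAM0 : 0 ≤ A * M := by positivity
  have hC : 0 < C := by rw [hCdef]; linarith
  have hCDle : CD ≤ C := by rw [hCdef]; linarith
  have hofA : ∀ B : ℝ, B ≤ A → B * M ≤ C := fun B hB =>
    calc B * M ≤ A * M := mul_le_mul_of_nonneg_right hB hM0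
      _ ≤ C := by rw [hCdef]; linarith
  have hAM : A ≤ A * M := le_mul_of_one_le_right hA0 hM1
  have hC3 : CT * (4:ℝ) ^ (1 + αT) ≤ C := by rw [hCdef]; linarith
  refine ⟨C, γ, K, hC, hγ, hK, fun η hη => ?_⟩
  -- the empty case (radius beyond the diameter), uniformly in `η`
  have hempty : ∀ (E : DiscreteDobrushin), E.Ω = D.carrier → ∀ (w : Site 2), ‖meshPoint E.δ w‖ < η →
      ∀ (z : ℂ) (r R : ℝ), z ∈ frontier D.carrier → 0 < r → 0 < R → Lsum + η ≤ R →
      μ.real (ufrsStrands E w z 3 r R) ≤ C * (r / R) ^ γ ∧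
        (z ∉ ufrsMarkedNbhd E w (2 * R) → μ.real (ufrsStrands E w z 3 r R) ≤ C * (r / R) ^ (1 + γ)) := by
    intro E hEΩ w hw z r R hz hr hR hbig
    have hzcl : z ∈ closure (Set.Ioo x₀ x₁ ×ℂ Set.Ioo y₀ y₁) := hD ▸ frontier_subset_closure hz
    have he : ufrsStrands E w z 3 r R = ∅ :=
      ufrsStrands_rect_eq_empty (hEΩ.trans hD) hw hzcl (by norm_num) (by rw [hLsumdef] at hbig; exact hbig)
    rw [he, measureReal_empty]
    exact ⟨by positivity, fun _ => by positivity⟩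
  by_cases hηlt : η < η₀
  swap
  · -- `η ≥ η₀`: the radius `R ≥ K r ≥ 8 K η` exceeds the diameter
    rw [not_lt] at hηlt
    refine ⟨1, one_pos, fun E hEΩ hE hEδ w hw z r R hz hr hR => ?_⟩
    have hr0 : 0 < r := by linarith
    have h1 : Lsum ≤ Lsum / η₀ * η := by
      rw [div_mul_eq_mul_div, le_div_iff₀ hη₀]
      exact mul_le_mul_of_nonneg_left hηlt hLsum.le
    have hpos : 0 ≤ Lsum / η₀ + 1 := by positivity
    have h2 : (Lsum / η₀ + 1) * η ≤ K * r :=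
      calc (Lsum / η₀ + 1) * η ≤ (Lsum / η₀ + 1) * r := mul_le_mul_of_nonneg_left (by linarith) hpos
        _ ≤ K * r := mul_le_mul_of_nonneg_right (le_max_right _ _) hr0.le
    have h3 : (Lsum / η₀ + 1) * η = Lsum / η₀ * η + η := by ring
    exact hempty E hEΩ w hw z r R hz hr0 (by linarith) (by linarith)
  -- the main case `η < η₀`
  obtain ⟨δT, hδT, hT'⟩ := hT η hη (lt_of_lt_of_le hηlt (min_le_left _ _))
  obtain ⟨δJ, hδJ, hJ'⟩ := hJ η hη (lt_of_lt_of_le hηlt ((min_le_right _ _).trans (min_le_left _ _)))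
  obtain ⟨δ1, hδ1, hO'⟩ := hO η hη (lt_of_lt_of_le hηlt ((min_le_right _ _).trans (min_le_right _ _)))
  refine ⟨min (min δT (min δJ δ1)) η, lt_min (lt_min hδT (lt_min hδJ hδ1)) hη,
    fun E hEΩ hE hEδ w hw z r R hz hr hR => ?_⟩
  have hδ : 0 < E.δ := hE.delta_pos
  have hEδT : E.δ < δT := lt_of_lt_of_le hEδ ((min_le_left _ _).trans (min_le_left _ _))
  have hEδJ : E.δ < δJ := lt_of_lt_of_le hEδ ((min_le_left _ _).trans ((min_le_right _ _).trans (min_le_left _ _)))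
  have hEδ1 : E.δ < δ1 := lt_of_lt_of_le hEδ ((min_le_left _ _).trans ((min_le_right _ _).trans (min_le_right _ _)))
  have hδη : E.δ < η := lt_of_lt_of_le hEδ (min_le_right _ _)
  have hr0 : 0 < r := by linarith
  have hRr : 2 ^ 12 * r ≤ R := le_trans (mul_le_mul_of_nonneg_right hK12 hr0.le) hR
  have hR0 : 0 < R := by linarith
  have hx01 : 0 ≤ r / R := by positivity
  have hx1 : r / R ≤ 1 := by rw [div_le_one hR0]; linarith
  by_cases hRbig : Lsum + η₀ ≤ R
  · exact hempty E hEΩ w hw z r R hz hr0 hR0 (by linarith)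
  rw [not_le] at hRbig
  -- the bridges read at the datum
  have hJloc := hJ' E hEΩ hE hEδJ w hw
  have hOloc := hO' E hEΩ hE hEδ1 w hw
  -- re-centring and the junction set
  obtain ⟨z', hz'D, hzz', hz'd⟩ := exists_recentre hDopen hz (by positivity : (0:ℝ) < r / 4)
  obtain ⟨J, -, hJiff⟩ := exists_junctionFinset hE w
  have hfree_of : ∀ (c : ℂ) (t X : ℝ), dist z c ≤ t → (∀ m ∈ J, X + t ≤ dist m z) →
      ∀ e₀ : Sym2 (Site 2), (e₀ ∈ E.zdABEdges ∨ e₀ ∈ (shiftData E w).zdABEdges) →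
        X ≤ dist (medialPoint E.δ e₀) c := by
    intro c t X hc hfar e₀ he₀
    have hm := hfar _ (medialPoint_mem_junctionFinset hJiff he₀)
    linarith [dist_triangle (medialPoint E.δ e₀) c z, dist_comm z c]
  constructor
  swap
  · -- the three-arm clause: HT at `(z'; 2r, R/2)`
    intro hfree
    have hfar : ∀ m ∈ J, R + r / 4 ≤ dist m z := by
      intro m hm
      by_contra hlt
      rw [not_le] at hlt
      exact hfree ((hJiff z (2 * R)).2 ⟨m, hm, by linarith⟩)
    have hjf := hfree_of z' (r / 4) (2 * (R / 2)) hzz'.le (fun m hm => by linarith [hfar m hm])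
    have hsub : ufrsStrands E w z 3 r R ⊆ ufrsStrands E w z' 3 (2 * r) (R / 2) :=
      ufrsStrands_mono (by linarith [hzz'.le]) (by linarith [hzz'.le])
    have hb := hT' E hEΩ hE hEδT w hw z' (2 * r) (R / 2) hz'D (by linarith) (by linarith) (by positivity) hjf
    have hratio : 2 * r / (R / 2) = 4 * (r / R) := by field_simp; ring
    calc μ.real (ufrsStrands E w z 3 r R) ≤ μ.real (ufrsStrands E w z' 3 (2 * r) (R / 2)) :=
          measureReal_mono hsub (measure_ne_top _ _)
      _ ≤ CT * (2 * r / (R / 2)) ^ (1 + αT) := hb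
      _ = CT * ((4:ℝ) ^ (1 + αT) * (r / R) ^ (1 + αT)) := by
          rw [hratio, Real.mul_rpow (by norm_num) hx01]
      _ ≤ CT * ((4:ℝ) ^ (1 + αT) * (r / R) ^ (1 + γ)) :=
          mul_le_mul_of_nonneg_left (mul_le_mul_of_nonneg_left
            (Real.rpow_le_rpow_of_exponent_ge' hx01 hx1 (by positivity) (by linarith)) (by positivity)) hCT.le
      _ = (CT * (4:ℝ) ^ (1 + αT)) * (r / R) ^ (1 + γ) := by ring
      _ ≤ C * (r / R) ^ (1 + γ) := mul_le_mul_of_nonneg_right hC3 (by positivity)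
  · -- the one-arm clause, at the shrunken outer radius `R₁ = min R (L₀/16)`
    set R₁ : ℝ := min R (L₀ / 16) with hR₁def
    have hR₁R : R₁ ≤ R := min_le_left _ _
    have hR₁0 : 0 < R₁ := lt_min hR0 (by positivity)
    have hMR : r / R₁ ≤ M * (r / R) := by
      rcases le_total R (L₀ / 16) with h | h
      · rw [hR₁def, min_eq_left h]
        exact le_mul_of_one_le_left hx01 hM1
      · rw [hR₁def, min_eq_right h, hMdef]
        have hlhs : r / (L₀ / 16) = 16 * r / L₀ := by field_simp
        have hrhs : 16 * R₀ / L₀ * (r / R) = (16 * r / L₀) * (R₀ / R) := by field_simp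
        rw [hlhs, hrhs]
        have h1 : 1 ≤ R₀ / R := by rw [le_div_iff₀ hR0, hR₀def]; linarith
        exact le_mul_of_one_le_right (by positivity) h1
    have final : ∀ B : ℝ, 0 ≤ B → B * M ≤ C →
        μ.real (ufrsStrands E w z 3 r R₁) ≤ B * (r / R₁) ^ γ → μ.real (ufrsStrands E w z 3 r R) ≤ C * (r / R) ^ γ := by
      intro B hB hBM hle
      calc μ.real (ufrsStrands E w z 3 r R) ≤ μ.real (ufrsStrands E w z 3 r R₁) :=
            measureReal_mono (ufrsStrands_mono_radii le_rfl hR₁R) (measure_ne_top _ _)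
        _ ≤ B * (r / R₁) ^ γ := hle
        _ ≤ B * (M * (r / R) ^ γ) :=
            mul_le_mul_of_nonneg_left (rpow_le_mul_rpow (by positivity) hx01 hM1 hMR hγ hγ1) hB
        _ = (B * M) * (r / R) ^ γ := by ring
        _ ≤ C * (r / R) ^ γ := mul_le_mul_of_nonneg_right hBM (by positivity)
    by_cases htriv : R₁ ≤ 2 ^ 10 * r
    · -- degenerate aspect ratio: the bound is at least one
      have hRCD : R ≤ CD * r := by
        rcases le_total R (L₀ / 16) with h | h
        · have h' : R₁ = R := min_eq_left h
          rw [h'] at htriv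
          exact htriv.trans (mul_le_mul_of_nonneg_right (le_trans (by norm_num) hCD1) hr0.le)
        · have h' : R₁ = L₀ / 16 := min_eq_right h
          rw [h'] at htriv
          have h1 : L₀ ≤ 2 ^ 14 * r := by linarith
          have h2 : R₀ ≤ CD * r := by
            rw [hCDdef, div_mul_eq_mul_div, le_div_iff₀ hL₀]
            calc R₀ * L₀ ≤ R₀ * (2 ^ 14 * r) := mul_le_mul_of_nonneg_left h1 hR₀.le
              _ = 2 ^ 14 * R₀ * r := by ring
          rw [hR₀def] at h2
          linarith
      have hlow : 1 ≤ C * (r / R) ^ γ := by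
        have h1 : r / R ≤ (r / R) ^ γ := by
          have := Real.rpow_le_rpow_of_exponent_ge' hx01 hx1 hγ.le hγ1
          rwa [Real.rpow_one] at this
        have h2 : 1 ≤ CD * (r / R) := by
          rw [mul_div_assoc', le_div_iff₀ hR0, one_mul]; exact hRCD
        calc (1:ℝ) ≤ CD * (r / R) := h2
          _ ≤ C * (r / R) ^ γ := mul_le_mul hCDle h1 hx01 hC.le
      exact measureReal_le_one.trans hlow
    rw [not_le] at htriv
    by_cases hnear : ∃ m ∈ J, dist m z ≤ 32 * r
    · -- (A)
      obtain ⟨m, hmJ, hmz⟩ := hnear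
      obtain ⟨e₀, he₀, hme⟩ := exists_markedEdge_of_mem_junctionFinset hJiff hmJ
      rw [← hme] at hmz
      exact final (66 * CJ) (by positivity) (hofA _ (by rw [hAdef]; linarith))
        (oneArm_near hCJ hγ hγ1 hγβ hJloc he₀ hmz hr hr0 htriv)
    push Not at hnear
    by_cases hfarJ : ∀ m ∈ J, R₁ ≤ dist m z
    · -- (B1)
      have hjf := hfree_of z' (r / 4) (2 * (R₁ / 2 - r)) hzz'.le (fun m hm => by linarith [hfarJ m hm])
      have h8C : 8 * C1 * M ≤ C := by
        have : 0 ≤ C1 * M := by positivity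
        linarith [hofA _ (show 128 * C1 ≤ A by rw [hAdef]; linarith)]
      exact final (8 * C1) (by positivity) h8C
        (oneArm_far hC1 hγ hγ1 hγ1' hOloc hz'D hz'd hzz' hjf hr hr0 htriv)
    -- (B2)
    push Not at hfarJ
    obtain ⟨m₁, hm₁J, hm₁⟩ := hfarJ
    obtain ⟨m₀, hm₀J, hm₀min⟩ := J.exists_min_image (fun m => dist m z) ⟨m₁, hm₁J⟩
    obtain ⟨e₀, he₀, hme⟩ := exists_markedEdge_of_mem_junctionFinset hJiff hm₀J
    have hu32 : 32 * r < dist m₀ z := hnear m₀ hm₀J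
    have huR : dist m₀ z < R₁ := lt_of_le_of_lt (hm₀min m₁ hm₁J) hm₁
    have hjf := hfree_of z' (r / 4) (2 * (dist m₀ z / 8)) hzz'.le (fun m hm => by linarith [hm₀min m hm])
    by_cases hu8 : R₁ ≤ 8 * dist m₀ z
    · -- (B2a)
      exact final (128 * C1) (by positivity) (hofA _ (by rw [hAdef]; linarith))
        (oneArm_mid hC1 hγ hγ1 hγ1' hOloc hz'D hz'd hzz' hjf hr hr0 hu32 huR hu8)
    · -- (B2b)
      rw [not_le] at hu8
      rw [← hme] at hu32 hu8 hjf
      exact final (64 * C1 * CJ) (by positivity) (hofA _ (by rw [hAdef]; linarith))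
        (oneArm_split hδ hδη hC1 hCJ hγ hγ1 hγ1' hγβ hOloc hJloc hz'D hz'd hzz' he₀ rfl hjf hr hr0 hu32 hu8)

end

end Summit.CriticalPhenomena.CardyFormulaZ2.Cruxes.EdgePrecompact.QkzStripBoundaryArm
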